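import Summits.BirchSwinnertonDyer.BirchSwinnertonDyer.Theorems.ResidualThetaTransportAtTwoRlfCorSurj
import Literature.NumberTheory.EllipticCurves.Kobayashi2003.SignedSelmer
import Literature.NumberTheory.GaloisCohomology.LocalInvariantMap
import HarnessLib

/-!
# Route `ResidualThetaTransportAtTwo` (RTT P6, item stmt-BirchSwinnertonDyer-23110), skeleton `hplusdual`: the registered stub
# `stub_iso` FOLLOWS FROM LAYER-ISO ALONE (closer modulo the one remaining research statement)

Width seat `bsd-wall-tp2-p2x-w2` g16 (cell `bsd-wall`), for the LEAD `bsd-wall-tp2-p2x` g13 (item claimed; skeleton `hplusdual` with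
stubs `stub_hWL`, `stub_h412` (PRINT) and `stub_iso`). HONEST FRAMING: THEOREMS ONLY; this file does NOT prove `stub_iso` — it reduces
it, VERBATIM, to the displayed hypothesis LAYER-ISO (B. D. Kim's Prop. 3.15 read at `2` for the untwisted layer-`J` classes with
`A`-witness in the K3 Shapiro currency, the target of the LEAD's layer dictionary + w3's θ-extraction); closes no item; 23110 is NOT
proved; BSD is NOT proved by any of this.

* **`stub_iso_of_layerIso`** — `(∀ E κ, GoodSS E 2 → a₂(E) = 0 → κ cyclotomic → LAYER-ISO(E, κ)) → stub_iso` (statement of the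
  registered stub VERBATIM), with the EMPTY exceptional set `B = ∅`: `TwistedLocalKummer.iso_of_layerIso` (COR-SURJ + untwisting +
  top projection formula + PT-dialect link, all in the tree) for every odd `u`.

References: B. D. Kim, Compositio Math. 143 (2007), Props. 3.15, 3.18, 4.11 [BDKim2007]; S. Kobayashi, Invent. math. 152 (2003),
Thm. 1.2, Def. 1.1 [Kobayashi2003].
-/

-- the Theorems namespace of this sub repeats the summit name by design (D-0017 nested layout)
set_option linter.dupNamespace false

noncomputable section

open scoped Classical NumberField
open NumberField IsDedekindDomain Field

namespace Summit.BirchSwinnertonDyer.BirchSwinnertonDyer.Theorems.SignedEC.TwistedLocalKummer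

open Literature.NumberTheory.EllipticCurves Literature.NumberTheory.GaloisRepresentations
  Literature.NumberTheory.GaloisCohomology WeierstrassCurve ZpExtension Literature.NumberTheory.EllipticCurves.Kobayashi2003
  Literature.NumberTheory.EllipticCurves.Rank1Residual SignedKatoOffTwo
open Literature.NumberTheory.GaloisRepresentations.DiscreteGaloisModule (localTatePairingZMod)
open scoped ContRepresentation

/-- **`stub_iso` ⟸ LAYER-ISO.** If for every globally minimal `E/ℚ` with `GoodSS E 2`, `a₂(E) = 0` and every cyclotomic `ℤ₂`-extension
`κ` the UNTWISTED layer-`J` classes with `A`-witness (`A = ⋃ₙ E⁺(ℚ_{v,n})`) are isotropic for the K3 layer pairing at every `v ∋ 2`,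
level `J` and alternating non-degenerate equivariant Weil datum (LAYER-ISO), then the registered stub `stub_iso` of the skeleton
`hplusdual` holds — with the empty exceptional set: `hiso(u)` for EVERY odd `u` (`iso_of_layerIso`).
[cite: BDKim2007, Props. 3.15, 3.18, 4.11] [cite: Kobayashi2003, Thm. 1.2] -/
theorem stub_iso_of_layerIso
    (hLI : ∀ (E : WeierstrassCurve ℚ) [E.IsElliptic] [E.IsGloballyMinimal], GoodSS E 2 → E.frobeniusTrace 2 = 0 →
      ∀ (κ : ZpExtension ℚ 2), κ.IsCyclotomic →
      ∀ (J : ℕ) (e : E.geomTorsion ((2 ^ J : ℕ) : ℤ) → E.geomTorsion ((2 ^ J : ℕ) : ℤ) → AlgebraicClosure ℚ)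
      (hμ : ∀ S T, e S T ^ (2 ^ J) = 1) (hadd₁ : ∀ S₁ S₂ T, e (S₁ + S₂) T = e S₁ T * e S₂ T)
      (hadd₂ : ∀ S T₁ T₂, e S (T₁ + T₂) = e S T₁ * e S T₂)
      (hgal : ∀ (σ : absoluteGaloisGroup ℚ) (S T : E.geomTorsion ((2 ^ J : ℕ) : ℤ)), σ • e S T = e (σ • S) (σ • T)),
      (∀ T, e T T = 1) → (∀ T, (∀ S, e S T = 1) → T = 0) → ∀ [NeZero (2 ^ J)],
      ∀ (v : HeightOneSpectrum (𝓞 ℚ)) [CompactSpace (absoluteGaloisGroup (v.adicCompletion ℚ))], ((2 : ℕ) : 𝓞 ℚ) ∈ v.asIdeal →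
      ∀ (f₀ g₀ : contOneCocycles (subgroupRep (LayerPairing.torsionLocalRep E (2 ^ J) v) (LayerPairing.layerGroup κ v J)))
        (Qf Qg : localPoints E (v.adicCompletion ℚ)) (kf kg : ℕ),
        2 ^ kf • Qf ∈ (⨆ n : ℕ, signedLocalPoints κ (v.adicCompletion ℚ) E 1 n) →
        (∀ (τ : absoluteGaloisGroup (v.adicCompletion ℚ)) (hτ : τ ∈ localSubgroup κ.kerSubgroup (v.adicCompletion ℚ)),
          pointsMap E (v.adicCompletion ℚ) ((f₀.1 ⟨τ, kerLocal_le_layerGroup κ v J hτ⟩ : E.geomTorsion ((2 ^ J : ℕ) : ℤ)) :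
            E.geomPoints) = τ • Qf - Qf) →
        2 ^ kg • Qg ∈ (⨆ n : ℕ, signedLocalPoints κ (v.adicCompletion ℚ) E 1 n) →
        (∀ (τ : absoluteGaloisGroup (v.adicCompletion ℚ)) (hτ : τ ∈ localSubgroup κ.kerSubgroup (v.adicCompletion ℚ)),
          pointsMap E (v.adicCompletion ℚ) ((g₀.1 ⟨τ, kerLocal_le_layerGroup κ v J hτ⟩ : E.geomTorsion ((2 ^ J : ℕ) : ℤ)) :
            E.geomPoints) = τ • Qg - Qg) →
        (LayerPairing.layerSumPairing E (2 ^ J) e hμ hadd₁ hadd₂ hgal κ v J).cupProduct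
          (LayerPairing.layerShapiro E (2 ^ J) κ v J (oneCocycleClass _ f₀))
          (LayerPairing.layerShapiro E (2 ^ J) κ v J (oneCocycleClass _ g₀)) = 0) :
    ∀ (κ : ZpExtension ℚ 2) (γ : Field.absoluteGaloisGroup ℚ), κ.IsCyclotomic → κ.IsTopGenerator γ →
      ∀ (S₀ : Finset (HeightOneSpectrum (𝓞 ℚ))), (∀ v ∈ S₀, ((2 : ℕ) : 𝓞 ℚ) ∉ v.asIdeal) →
      ∀ (E : WeierstrassCurve ℚ) [E.IsElliptic] [E.IsGloballyMinimal], GoodSS E 2 → E.frobeniusTrace 2 = 0 → E.Δ < 0 →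
        (∀ v : HeightOneSpectrum (𝓞 ℚ), ¬ E.HasGoodReductionAt v → v ∈ S₀) →
      ∀ (D : SignedSelmerDualData E κ γ 1) [Module.Finite (IwasawaAlgebra 2) D.X],
        Module.IsTorsion (IwasawaAlgebra 2) D.X → D.mu = 0 →
      ∃ B : Set ℤ, B.Finite ∧ ∀ u : ℤ, u ∉ B → ∀ hu : (2 : ℤ) ∣ u - 1,
        (∀ (J : ℕ) (u' : ℤ) (hu' : (2 : ℤ) ∣ u' - 1) (huu' : ((2 : ℤ) ^ J) ∣ u * u' - 1)
      (e : E.geomTorsion ((2 ^ J : ℕ) : ℤ) → E.geomTorsion ((2 ^ J : ℕ) : ℤ) → AlgebraicClosure ℚ)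
      (hμ : ∀ S T, e S T ^ (2 ^ J) = 1) (hadd₁ : ∀ S₁ S₂ T, e (S₁ + S₂) T = e S₁ T * e S₂ T)
      (hadd₂ : ∀ S T₁ T₂, e S (T₁ + T₂) = e S T₁ * e S T₂)
      (hgal : ∀ (σ : absoluteGaloisGroup ℚ) (S T : E.geomTorsion ((2 ^ J : ℕ) : ℤ)), σ • e S T = e (σ • S) (σ • T))
      (halt : ∀ T, e T T = 1) (hnondeg : ∀ T, (∀ S, e S T = 1) → T = 0)
      [Finite (E.geomTorsion ((2 ^ J : ℕ) : ℤ))]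
      (inv : LocalInvariants ℚ (2 ^ J)), inv.IsPerfect →
      ∀ (v : HeightOneSpectrum (𝓞 ℚ)), ((2 : ℕ) : 𝓞 ℚ) ∈ v.asIdeal →
      ∀ x ∈ E.twistedTorsionLocalKummer 2 κ J u hu (v.adicCompletion ℚ) (⨆ n : ℕ, signedLocalPoints κ (v.adicCompletion ℚ) E 1 n),
      ∀ y' ∈ E.twistedTorsionLocalKummer 2 κ J u' hu' (v.adicCompletion ℚ) (⨆ n : ℕ, signedLocalPoints κ (v.adicCompletion ℚ) E 1 n),
        localTatePairingZMod (E.twistedTorsionGaloisModule 2 κ J u hu) (2 ^ J) (Sum.inr v) (inv (Sum.inr v)) x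
          (galoisCohomology.map ((E.twistedWeilDual 2 κ J hu hu' huu' e hμ hadd₁ hadd₂ hgal).restrictField (v.adicCompletion ℚ)) 1
            y') = 0) := by
  intro κ γ hκ _ S₀ _ E _ _ hss ha _ _ D _ _ _
  exact ⟨∅, Set.finite_empty, fun u _ hu ↦ iso_of_layerIso E hss ha hκ u hu (hLI E hss ha κ hκ)⟩

/-- **`stub_iso` ⟸ LAYER-ISO read through THE local invariant map** (the currency of the LEAD's layer class pairings
`SignedEC.LayerClassPairing.invAt_cupProduct_layerShapiro_*`): the same reduction with the layer isotropy stated as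
`inv_v(Sh_J[f₀] ∪_{Σe} Sh_J[g₀]) = 0` for `LayerPairing.invAt` (injective: `localInvariantMap_bijective`).
[cite: BDKim2007, Props. 3.15, 3.18, 4.11] [cite: MilneADT2006, Ch. I §1, Cor. 2.3] -/
theorem stub_iso_of_layerIsoInvAt
    (hLI : ∀ (E : WeierstrassCurve ℚ) [E.IsElliptic] [E.IsGloballyMinimal], GoodSS E 2 → E.frobeniusTrace 2 = 0 →
      ∀ (κ : ZpExtension ℚ 2), κ.IsCyclotomic →
      ∀ (J : ℕ) (e : E.geomTorsion ((2 ^ J : ℕ) : ℤ) → E.geomTorsion ((2 ^ J : ℕ) : ℤ) → AlgebraicClosure ℚ)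
      (hμ : ∀ S T, e S T ^ (2 ^ J) = 1) (hadd₁ : ∀ S₁ S₂ T, e (S₁ + S₂) T = e S₁ T * e S₂ T)
      (hadd₂ : ∀ S T₁ T₂, e S (T₁ + T₂) = e S T₁ * e S T₂)
      (hgal : ∀ (σ : absoluteGaloisGroup ℚ) (S T : E.geomTorsion ((2 ^ J : ℕ) : ℤ)), σ • e S T = e (σ • S) (σ • T)),
      (∀ T, e T T = 1) → (∀ T, (∀ S, e S T = 1) → T = 0) → ∀ [NeZero (2 ^ J)],
      ∀ (v : HeightOneSpectrum (𝓞 ℚ)) [CompactSpace (absoluteGaloisGroup (v.adicCompletion ℚ))], ((2 : ℕ) : 𝓞 ℚ) ∈ v.asIdeal →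
      ∀ (f₀ g₀ : contOneCocycles (subgroupRep (LayerPairing.torsionLocalRep E (2 ^ J) v) (LayerPairing.layerGroup κ v J)))
        (Qf Qg : localPoints E (v.adicCompletion ℚ)) (kf kg : ℕ),
        2 ^ kf • Qf ∈ (⨆ n : ℕ, signedLocalPoints κ (v.adicCompletion ℚ) E 1 n) →
        (∀ (τ : absoluteGaloisGroup (v.adicCompletion ℚ)) (hτ : τ ∈ localSubgroup κ.kerSubgroup (v.adicCompletion ℚ)),
          pointsMap E (v.adicCompletion ℚ) ((f₀.1 ⟨τ, kerLocal_le_layerGroup κ v J hτ⟩ : E.geomTorsion ((2 ^ J : ℕ) : ℤ)) :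
            E.geomPoints) = τ • Qf - Qf) →
        2 ^ kg • Qg ∈ (⨆ n : ℕ, signedLocalPoints κ (v.adicCompletion ℚ) E 1 n) →
        (∀ (τ : absoluteGaloisGroup (v.adicCompletion ℚ)) (hτ : τ ∈ localSubgroup κ.kerSubgroup (v.adicCompletion ℚ)),
          pointsMap E (v.adicCompletion ℚ) ((g₀.1 ⟨τ, kerLocal_le_layerGroup κ v J hτ⟩ : E.geomTorsion ((2 ^ J : ℕ) : ℤ)) :
            E.geomPoints) = τ • Qg - Qg) →
        LayerPairing.invAt (2 ^ J) v ((LayerPairing.layerSumPairing E (2 ^ J) e hμ hadd₁ hadd₂ hgal κ v J).cupProduct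
          (LayerPairing.layerShapiro E (2 ^ J) κ v J (oneCocycleClass _ f₀))
          (LayerPairing.layerShapiro E (2 ^ J) κ v J (oneCocycleClass _ g₀))) = 0) :
    ∀ (κ : ZpExtension ℚ 2) (γ : Field.absoluteGaloisGroup ℚ), κ.IsCyclotomic → κ.IsTopGenerator γ →
      ∀ (S₀ : Finset (HeightOneSpectrum (𝓞 ℚ))), (∀ v ∈ S₀, ((2 : ℕ) : 𝓞 ℚ) ∉ v.asIdeal) →
      ∀ (E : WeierstrassCurve ℚ) [E.IsElliptic] [E.IsGloballyMinimal], GoodSS E 2 → E.frobeniusTrace 2 = 0 → E.Δ < 0 →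
        (∀ v : HeightOneSpectrum (𝓞 ℚ), ¬ E.HasGoodReductionAt v → v ∈ S₀) →
      ∀ (D : SignedSelmerDualData E κ γ 1) [Module.Finite (IwasawaAlgebra 2) D.X],
        Module.IsTorsion (IwasawaAlgebra 2) D.X → D.mu = 0 →
      ∃ B : Set ℤ, B.Finite ∧ ∀ u : ℤ, u ∉ B → ∀ hu : (2 : ℤ) ∣ u - 1,
        (∀ (J : ℕ) (u' : ℤ) (hu' : (2 : ℤ) ∣ u' - 1) (huu' : ((2 : ℤ) ^ J) ∣ u * u' - 1)
      (e : E.geomTorsion ((2 ^ J : ℕ) : ℤ) → E.geomTorsion ((2 ^ J : ℕ) : ℤ) → AlgebraicClosure ℚ)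
      (hμ : ∀ S T, e S T ^ (2 ^ J) = 1) (hadd₁ : ∀ S₁ S₂ T, e (S₁ + S₂) T = e S₁ T * e S₂ T)
      (hadd₂ : ∀ S T₁ T₂, e S (T₁ + T₂) = e S T₁ * e S T₂)
      (hgal : ∀ (σ : absoluteGaloisGroup ℚ) (S T : E.geomTorsion ((2 ^ J : ℕ) : ℤ)), σ • e S T = e (σ • S) (σ • T))
      (halt : ∀ T, e T T = 1) (hnondeg : ∀ T, (∀ S, e S T = 1) → T = 0)
      [Finite (E.geomTorsion ((2 ^ J : ℕ) : ℤ))]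
      (inv : LocalInvariants ℚ (2 ^ J)), inv.IsPerfect →
      ∀ (v : HeightOneSpectrum (𝓞 ℚ)), ((2 : ℕ) : 𝓞 ℚ) ∈ v.asIdeal →
      ∀ x ∈ E.twistedTorsionLocalKummer 2 κ J u hu (v.adicCompletion ℚ) (⨆ n : ℕ, signedLocalPoints κ (v.adicCompletion ℚ) E 1 n),
      ∀ y' ∈ E.twistedTorsionLocalKummer 2 κ J u' hu' (v.adicCompletion ℚ) (⨆ n : ℕ, signedLocalPoints κ (v.adicCompletion ℚ) E 1 n),
        localTatePairingZMod (E.twistedTorsionGaloisModule 2 κ J u hu) (2 ^ J) (Sum.inr v) (inv (Sum.inr v)) x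
          (galoisCohomology.map ((E.twistedWeilDual 2 κ J hu hu' huu' e hμ hadd₁ hadd₂ hgal).restrictField (v.adicCompletion ℚ)) 1
            y') = 0) :=
  stub_iso_of_layerIso fun E _ _ hss ha κ hκ J e hμ hadd₁ hadd₂ hgal halt hnd _ v _ hv f₀ g₀ Qf Qg kf kg h1 h2 h3 h4 ↦
    (localInvariantMap_bijective (K := ℚ) (n := 2 ^ J) v).1 (by
      change LayerPairing.invAt (2 ^ J) v _ = LayerPairing.invAt (2 ^ J) v 0
      rw [map_zero]
      exact hLI E hss ha κ hκ J e hμ hadd₁ hadd₂ hgal halt hnd v hv f₀ g₀ Qf Qg kf kg h1 h2 h3 h4)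

end Summit.BirchSwinnertonDyer.BirchSwinnertonDyer.Theorems.SignedEC.TwistedLocalKummer

end
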